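import Literature.Analysis.Complex.HormanderL2Estimate
import HarnessLib

/-!
# Graph data for `T*` and `S`, multipliers and cut-offs (Hörmander, Lemma 4.1.3, first half)

Layer `Literature/Analysis/Complex`; continues `HormanderL2Operators.lean` (L. Hörmander, *An
Introduction to Complex Analysis in Several Variables* (1973), §4.1, Lemma 4.1.3 and (4.1.6)–(4.1.8),
p. 79–80).

For weights `W = (φ₁, φ₂, φ₃)` on a Riemann domain `D` we package the **graph data** of a form
`f ∈ L²_{(0,1)}(D, φ₂)`: `GraphData W f t s` says `f_j ∈ L²(φ₂)`, `t ∈ L²(φ₁)`, `s_{jk} ∈ L²(φ₃)`,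
`S f = s` weakly (`HasWeakDbarForm`) and `T* f = t` in the weak (distributional) form
`∑_j ∂_j (e^{-φ₂} f_j) = -e^{-φ₁} t` (`HasWeakDelDiv`; this is how `f ∈ D_{T*}` is used, cf.
`HormanderL2Operators.hasWeakDelDiv_adjoint`). We prove:

* `GraphData.smul` — multiplication by a test function `χ`: `χ f` has graph data
  `(χ t - e^{φ₁-φ₂} ∑_j (∂_j χ) f_j, χ s + ∂̄χ ∧ f)` (Hörmander (4.1.7)–(4.1.8));
* `GraphData.tendsto_cutoff_f/t/s` — for cut-offs `η_ν ∈ C_c^∞(D; [0,1])`, eventually `1` near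
  every point, with (4.1.6) `∑_k |∂̄_k η_ν|² ≤ e^{φ₂-φ₁}` and `≤ e^{φ₃-φ₂}`, the three graph-norm
  errors of `η_ν f` tend to `0` (dominated convergence) — the first half of the proof of Lemma 4.1.3;
* tools: `memLp_two_volW_iff`, `memLp_two_volW_of_le`, `tendsto_eLpNorm_zero_of_dominated`.

Everything is proved; definitions: `GraphData`, `cutT`, `cutS`; no named facts.

## References

* L. Hörmander, *An Introduction to Complex Analysis in Several Variables* (1973), §4.1, Lemma 4.1.3,
  (4.1.6)–(4.1.8), p. 79–80. [HormanderSCV1973]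

#harness_tags complex_analysis.several_variables, complex_analysis.l2_estimates, complex_geometry.riemann_existence
-/

noncomputable section

open scoped Manifold ContDiff Topology ComplexConjugate NNReal InnerProductSpace ENNReal
open scoped LinearPMap
open Set Filter Function Complex MeasureTheory MeasureTheory.Measure

namespace Literature.Analysis.Complex

namespace RiemannDomain

universe u

variable {ι : Type} [Fintype ι] {D : RiemannDomain.{u} ι}

/-! ### `L²` tools for the weighted measures -/

section LpTools

variable {φ φ₁ φ₂ : D → ℝ}

/-- `g ∈ L²(D, e^{-φ} vol)` iff `|g|² e^{-φ}` is `vol`-integrable. [folklore] -/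
theorem memLp_two_volW_iff (hφ : Continuous φ) {E : Type*} [NormedAddCommGroup E] {g : D → E} (hg : AEStronglyMeasurable g D.vol) :
    MemLp g 2 (D.volW φ) ↔ Integrable (fun x ↦ ‖g x‖ ^ 2 * Real.exp (-φ x)) D.vol := by
  have hg' : AEStronglyMeasurable g (D.volW φ) := hg.mono_ac (volW_absolutelyContinuous φ)
  rw [memLp_two_iff_integrable_sq_norm hg', volW, integrable_withDensity_iff_integrable_smul (measurable_weight hφ)]
  refine integrable_congr (ae_of_all _ fun x ↦ ?_)
  simp only [NNReal.smul_def, coe_weight, smul_eq_mul]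
  ring

/-- AE-strong measurability for `vol` from membership in a weighted `L²`. [folklore] -/
theorem aestronglyMeasurable_of_memLp_volW (hφ : Continuous φ) {E : Type*} [NormedAddCommGroup E] {g : D → E}
    (hg : MemLp g 2 (D.volW φ)) :
    AEStronglyMeasurable g D.vol :=
  hg.1.mono_ac (vol_absolutelyContinuous_volW hφ)

/-- **Comparison of weighted `L²` memberships**: if `|h|² e^{-φ₁} ≤ C |g|² e^{-φ₂}` pointwise and
`g ∈ L²(φ₂)`, then `h ∈ L²(φ₁)`. [folklore] -/
theorem memLp_two_volW_of_le (hφ₁ : Continuous φ₁) (hφ₂ : Continuous φ₂) {E₁ E₂ : Type*} [NormedAddCommGroup E₁]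
    [NormedAddCommGroup E₂] {g : D → E₂} {h : D → E₁} {C : ℝ}
    (hg : MemLp g 2 (D.volW φ₂)) (hh : AEStronglyMeasurable h D.vol)
    (hle : ∀ x, ‖h x‖ ^ 2 * Real.exp (-φ₁ x) ≤ C * (‖g x‖ ^ 2 * Real.exp (-φ₂ x))) : MemLp h 2 (D.volW φ₁) := by
  rw [memLp_two_volW_iff hφ₁ hh]
  have hI := (memLp_two_volW_iff hφ₂ (aestronglyMeasurable_of_memLp_volW hφ₂ hg)).1 hg
  refine (hI.const_mul C).mono' ((hh.norm.pow 2).mul (Real.continuous_exp.comp hφ₁.neg).aestronglyMeasurable)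
    (ae_of_all _ fun x ↦ ?_)
  rw [Real.norm_eq_abs, abs_of_nonneg (by positivity)]
  exact hle x

/-- A bounded continuous multiplier preserves a weighted `L²`. [folklore] -/
theorem memLp_two_volW_mul_of_bound (hφ : Continuous φ) {m g : D → ℂ} {C : ℝ} (hm : Continuous m)
    (hC : ∀ x, ‖m x‖ ≤ C) (hg : MemLp g 2 (D.volW φ)) : MemLp (fun x ↦ m x * g x) 2 (D.volW φ) := by
  refine memLp_two_volW_of_le hφ hφ hg (hm.aestronglyMeasurable.mul (aestronglyMeasurable_of_memLp_volW hφ hg))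
    (C := C ^ 2) fun x ↦ ?_
  rw [norm_mul, mul_pow]
  have h1 : ‖m x‖ ^ 2 ≤ C ^ 2 := pow_le_pow_left₀ (norm_nonneg _) (hC x) 2
  have h2 : 0 ≤ ‖g x‖ ^ 2 * Real.exp (-φ x) := by positivity
  nlinarith

/-- **A compactly supported continuous multiplier maps `L²(φ₂)` into `L²(φ₁)`** for any two
continuous weights. [folklore] -/
theorem memLp_two_volW_mul_of_hasCompactSupport (hφ₁ : Continuous φ₁) (hφ₂ : Continuous φ₂) {m g : D → ℂ}
    (hm : Continuous m) (hmc : HasCompactSupport m) (hg : MemLp g 2 (D.volW φ₂)) :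
    MemLp (fun x ↦ m x * g x) 2 (D.volW φ₁) := by
  -- the continuous compactly supported `|m|² e^{φ₂ - φ₁}` is bounded
  have hb : Continuous fun x ↦ ‖m x‖ ^ 2 * Real.exp (φ₂ x - φ₁ x) :=
    (hm.norm.pow 2).mul (Real.continuous_exp.comp (hφ₂.sub hφ₁))
  have hbc : HasCompactSupport fun x ↦ ‖m x‖ ^ 2 * Real.exp (φ₂ x - φ₁ x) :=
    (hmc.norm.comp_left (g := fun r : ℝ ↦ r ^ 2) (by simp)).mul_right
  obtain ⟨C, hC⟩ := hb.bounded_above_of_compact_support hbc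
  refine memLp_two_volW_of_le hφ₁ hφ₂ hg (hm.aestronglyMeasurable.mul (aestronglyMeasurable_of_memLp_volW hφ₂ hg))
    (C := C) fun x ↦ ?_
  have h1 : ‖m x‖ ^ 2 * Real.exp (φ₂ x - φ₁ x) ≤ C := (Real.le_norm_self _).trans (hC x)
  have h2 : 0 ≤ ‖g x‖ ^ 2 * Real.exp (-φ₂ x) := by positivity
  have hE : Real.exp (-φ₁ x) = Real.exp (φ₂ x - φ₁ x) * Real.exp (-φ₂ x) := by
    rw [← Real.exp_add]; ring_nf
  calc ‖m x * g x‖ ^ 2 * Real.exp (-φ₁ x) = (‖m x‖ ^ 2 * Real.exp (φ₂ x - φ₁ x)) * (‖g x‖ ^ 2 * Real.exp (-φ₂ x)) := by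
        rw [norm_mul, mul_pow, hE]; ring
    _ ≤ C * (‖g x‖ ^ 2 * Real.exp (-φ₂ x)) := mul_le_mul_of_nonneg_right h1 h2

/-- **Dominated convergence in `L²`**: if `‖g_ν‖ ≤ b ∈ L²(μ)` pointwise and `g_ν → 0` pointwise,
then `‖g_ν‖_{L²(μ)} → 0`. [folklore] -/
theorem tendsto_eLpNorm_zero_of_dominated {α : Type*} [MeasurableSpace α] {μ : Measure α} {g : ℕ → α → ℂ}
    {b : α → ℝ} (hg : ∀ ν, AEStronglyMeasurable (g ν) μ) (hb : MemLp b 2 μ) (hle : ∀ ν x, ‖g ν x‖ ≤ b x)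
    (hlim : ∀ x, Tendsto (fun ν ↦ g ν x) atTop (𝓝 0)) : Tendsto (fun ν ↦ eLpNorm (g ν) 2 μ) atTop (𝓝 0) := by
  have h2 : (2 : ℝ≥0∞) ≠ 0 := two_ne_zero
  have h2' : (2 : ℝ≥0∞) ≠ ⊤ := ENNReal.ofNat_ne_top
  have hrepr : ∀ ν, eLpNorm (g ν) 2 μ = (∫⁻ x, ‖g ν x‖ₑ ^ (2 : ℝ) ∂μ) ^ (1 / (2 : ℝ)) := fun ν ↦ by
    rw [eLpNorm_eq_lintegral_rpow_enorm_toReal h2 h2', ENNReal.toReal_ofNat]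
  simp_rw [hrepr]
  have hlin : Tendsto (fun ν ↦ ∫⁻ x, ‖g ν x‖ₑ ^ (2 : ℝ) ∂μ) atTop (𝓝 0) := by
    have hbound : ∫⁻ x, ‖b x‖ₑ ^ (2 : ℝ) ∂μ ≠ ⊤ := by
      have := lintegral_rpow_enorm_lt_top_of_eLpNorm_lt_top h2 h2' hb.eLpNorm_lt_top
      rw [ENNReal.toReal_ofNat] at this
      exact this.ne
    have hmeas : ∀ ν, AEMeasurable (fun x ↦ ‖g ν x‖ₑ ^ (2 : ℝ)) μ := fun ν ↦
      (ENNReal.continuous_rpow_const.measurable.comp_aemeasurable (hg ν).enorm)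
    have hdom : ∀ ν, (fun x ↦ ‖g ν x‖ₑ ^ (2 : ℝ)) ≤ᵐ[μ] fun x ↦ ‖b x‖ₑ ^ (2 : ℝ) := fun ν ↦
      ae_of_all _ fun x ↦ by
        refine ENNReal.rpow_le_rpow ?_ (by norm_num)
        rw [← ofReal_norm, ← ofReal_norm]
        exact ENNReal.ofReal_le_ofReal ((hle ν x).trans (Real.le_norm_self _))
    have hpt : ∀ᵐ x ∂μ, Tendsto (fun ν ↦ ‖g ν x‖ₑ ^ (2 : ℝ)) atTop (𝓝 ((fun _ ↦ 0) x)) := ae_of_all _ fun x ↦ by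
      have h1 : Tendsto (fun ν ↦ ‖g ν x‖ₑ) atTop (𝓝 0) := by
        have := (continuous_enorm.tendsto (0 : ℂ)).comp (hlim x)
        rwa [enorm_zero] at this
      have := (ENNReal.continuous_rpow_const (y := (2 : ℝ)).tendsto 0).comp h1
      rw [ENNReal.zero_rpow_of_pos (show (0 : ℝ) < 2 by norm_num)] at this
      exact this
    have := tendsto_lintegral_of_dominated_convergence' (fun x ↦ ‖b x‖ₑ ^ (2 : ℝ)) hmeas hdom hbound hpt
    simpa using this
  have := (ENNReal.continuous_rpow_const (y := 1 / (2 : ℝ))).tendsto 0 |>.comp hlin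
  rw [ENNReal.zero_rpow_of_pos (show (0 : ℝ) < 1 / 2 by norm_num)] at this
  exact this

/-- A sequence which is eventually `0` tends to `0`. [folklore] -/
theorem tendsto_zero_of_eventually_eq {g : ℕ → ℂ} (h : ∀ᶠ ν in atTop, g ν = 0) : Tendsto g atTop (𝓝 0) :=
  tendsto_const_nhds.congr' (h.mono fun _ hν ↦ hν.symm)

end LpTools

/-! ### Flat derivatives of a function which is locally `1` -/

section LocallyOne

variable {η : D → ℝ} {x : D}

/-- If `η = 1` near `x` then the flat derivative of `η` (read in `ℂ`) vanishes at `x`. [folklore] -/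
theorem fderivF_ofReal_eq_zero_of_eventuallyEq (h : ∀ᶠ y in 𝓝 x, η y = 1) :
    fderivF (fun y ↦ (η y : ℂ)) x = 0 := by
  rw [fderivF]
  have hc : ContinuousAt (D.chart x).symm (D.proj x) := (D.chart x).continuousAt_symm (D.proj_mem_chart_target x)
  have ht : Tendsto (D.chart x).symm (𝓝 (D.proj x)) (𝓝 x) := by
    have := hc.tendsto
    rwa [D.chart_symm_proj] at this
  have hev : ((fun y ↦ (η y : ℂ)) ∘ (D.chart x).symm) =ᶠ[𝓝 (D.proj x)] fun _ ↦ (1 : ℂ) := by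
    filter_upwards [ht.eventually h] with z hz
    simp only [comp_apply, hz, ofReal_one]
  rw [hev.fderiv_eq, fderiv_const_apply]

/-- If `η = 1` near `x` then `∂̄_v η (x) = 0`. [folklore] -/
theorem dbar_ofReal_eq_zero_of_eventuallyEq (h : ∀ᶠ y in 𝓝 x, η y = 1) (v : ι → ℂ) :
    dbar v (fun y ↦ (η y : ℂ)) x = 0 := by
  rw [dbar_eq_fderivF, fderivF_ofReal_eq_zero_of_eventuallyEq h]
  simp

/-- If `η = 1` near `x` then `∂_v η (x) = 0`. [folklore] -/
theorem del_ofReal_eq_zero_of_eventuallyEq (h : ∀ᶠ y in 𝓝 x, η y = 1) (v : ι → ℂ) :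
    del v (fun y ↦ (η y : ℂ)) x = 0 := by
  rw [del_eq_fderivF, fderivF_ofReal_eq_zero_of_eventuallyEq h]
  simp

/-- `|∂_v η| = |∂̄_v η|` for a real function `η`. [folklore] -/
theorem norm_del_ofReal (η : D → ℝ) (v : ι → ℂ) (x : D) :
    ‖del v (fun y ↦ (η y : ℂ)) x‖ = ‖dbar v (fun y ↦ (η y : ℂ)) x‖ := by
  rw [Weights.dbar_ofReal_eq_conj_del, norm_conj]

end LocallyOne

namespace Weights

variable [DecidableEq ι] (W : Weights D)

/-! ### Graph data -/

/-- **Graph data of a form for `(T*, S)`**: `f ∈ L²_{(0,1)}(φ₂)` with `T* f = t ∈ L²(φ₁)` in the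
distributional form `∑_j ∂_j(e^{-φ₂} f_j) = -e^{-φ₁} t` and `S f = s ∈ L²_{(0,2)}(φ₃)` weakly
(`s_{jk} = ∂̄_j f_k - ∂̄_k f_j`). [cite: HormanderSCV1973, §4.1 (p. 78–80)] -/
structure GraphData (f : ι → D → ℂ) (t : D → ℂ) (s : ι → ι → D → ℂ) : Prop where
  /-- `f_j ∈ L²(φ₂)` -/
  memLp_f : ∀ j, MemLp (f j) 2 W.μ₂
  /-- `t ∈ L²(φ₁)` -/
  memLp_t : MemLp t 2 W.μ₁
  /-- `s_{jk} ∈ L²(φ₃)` -/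
  memLp_s : ∀ j k, MemLp (s j k) 2 W.μ₃
  /-- `S f = s` weakly -/
  weakS : HasWeakDbarForm D (fun x j ↦ f j x) (fun x j k ↦ s j k x)
  /-- `T* f = t` weakly: `∑_j ∂_j (e^{-φ₂} f_j) = -e^{-φ₁} t` -/
  weakT : HasWeakDelDiv D (fun x j ↦ f j x * (Real.exp (-W.φ₂ x) : ℂ)) (fun x ↦ -t x * (Real.exp (-W.φ₁ x) : ℂ))

/-- **The `T*`-datum of `χ f`**: `χ t - e^{φ₁-φ₂} ∑_j (∂_j χ) f_j` (Hörmander (4.1.8):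
`T*(η f) = η T* f + [T*, η] f`). [cite: HormanderSCV1973, §4.1 (4.1.8)] -/
def cutT (χ : D → ℂ) (f : ι → D → ℂ) (t : D → ℂ) (x : D) : ℂ :=
  χ x * t x - (Real.exp (W.φ₁ x - W.φ₂ x) : ℂ) * ∑ j, del (Pi.single j 1) χ x * f j x

/-- **The `S`-datum of `χ f`**: `χ s_{jk} + (∂̄_j χ) f_k - (∂̄_k χ) f_j` (Hörmander (4.1.7):
`S(η f) = η S f + ∂̄η ∧ f`). [cite: HormanderSCV1973, §4.1 (4.1.7)] -/
def cutS (χ : D → ℂ) (f : ι → D → ℂ) (s : ι → ι → D → ℂ) (j k : ι) (x : D) : ℂ :=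
  χ x * s j k x + (dbar (Pi.single j 1) χ x * f k x - dbar (Pi.single k 1) χ x * f j x)

variable {W}

/-- **Graph data of `f ∈ D_{T*}` with `S f = s ∈ L²(φ₃)`** (from the distributional identity of
`D_{T*}`, `hasWeakDelDiv_adjoint`). [cite: HormanderSCV1973, §4.1 (p. 80, (4.1.9))] -/
theorem graphData_of_mem_adjoint (f : W.T†.domain) {s : ι → ι → D → ℂ}
    (hs : HasWeakDbarForm D (fun x j ↦ ((f : W.H2) j : D → ℂ) x) (fun x j k ↦ s j k x))
    (hsL : ∀ j k, MemLp (s j k) 2 W.μ₃) :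
    W.GraphData (fun j x ↦ ((f : W.H2) j : D → ℂ) x) (W.T† f : D → ℂ) s where
  memLp_f _ := Lp.memLp _
  memLp_t := Lp.memLp _
  memLp_s := hsL
  weakS := hs
  weakT := hasWeakDelDiv_adjoint f

/-- **Graph data of `f ∈ D_{T*} ∩ F`** (`S f = 0`). [cite: HormanderSCV1973, §4.1 (p. 80)] -/
theorem graphData_of_mem_adjoint_of_mem_F (f : W.T†.domain) (hF : (f : W.H2) ∈ W.F) :
    W.GraphData (fun j x ↦ ((f : W.H2) j : D → ℂ) x) (W.T† f : D → ℂ) (fun _ _ _ ↦ 0) :=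
  graphData_of_mem_adjoint f (mem_F_iff.1 hF) fun _ _ ↦ MemLp.zero'

/-! ### Multiplication by a test function (4.1.7)–(4.1.8) -/

namespace GraphData

variable {f : ι → D → ℂ} {t : D → ℂ} {s : ι → ι → D → ℂ} {χ : D → ℂ}

/-- AE-strong measurability of the components for `vol`. [folklore] -/
theorem aestronglyMeasurable_f (h : W.GraphData f t s) (j : ι) : AEStronglyMeasurable (f j) D.vol :=
  aestronglyMeasurable_of_memLp_volW W.continuous₂ (h.memLp_f j)

/-- AE-strong measurability of the `T*`-datum for `vol`. [folklore] -/
theorem aestronglyMeasurable_t (h : W.GraphData f t s) : AEStronglyMeasurable t D.vol :=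
  aestronglyMeasurable_of_memLp_volW W.continuous₁ h.memLp_t

/-- AE-strong measurability of the `S`-datum for `vol`. [folklore] -/
theorem aestronglyMeasurable_s (h : W.GraphData f t s) (j k : ι) : AEStronglyMeasurable (s j k) D.vol :=
  aestronglyMeasurable_of_memLp_volW W.continuous₃ (h.memLp_s j k)

/-- `χ f_j ∈ L²(φ₂)` for a test function `χ`. [folklore] -/
theorem memLp_smul_f (h : W.GraphData f t s) (hχ : IsTest χ) (j : ι) : MemLp (fun x ↦ χ x * f j x) 2 W.μ₂ := by
  obtain ⟨C, hC⟩ := hχ.continuous.bounded_above_of_compact_support hχ.hasCompactSupport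
  exact memLp_two_volW_mul_of_bound W.continuous₂ hχ.continuous hC (h.memLp_f j)

/-- `cutT χ f t ∈ L²(φ₁)` for a test function `χ`. [cite: HormanderSCV1973, §4.1 (p. 79)] -/
theorem memLp_cutT (h : W.GraphData f t s) (hχ : IsTest χ) : MemLp (W.cutT χ f t) 2 W.μ₁ := by
  obtain ⟨C, hC⟩ := hχ.continuous.bounded_above_of_compact_support hχ.hasCompactSupport
  have h1 : MemLp (fun x ↦ χ x * t x) 2 W.μ₁ := memLp_two_volW_mul_of_bound W.continuous₁ hχ.continuous hC h.memLp_t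
  have h2 : ∀ j, MemLp (fun x ↦ ((Real.exp (W.φ₁ x - W.φ₂ x) : ℂ) * del (Pi.single j 1) χ x) * f j x) 2 W.μ₁ :=
    fun j ↦ memLp_two_volW_mul_of_hasCompactSupport W.continuous₁ W.continuous₂
      ((continuous_ofReal.comp (Real.continuous_exp.comp (W.continuous₁.sub W.continuous₂))).mul
        (hχ.del _).continuous) ((hχ.del _).hasCompactSupport.mul_left) (h.memLp_f j)
  have h3 : MemLp (fun x ↦ ∑ j, ((Real.exp (W.φ₁ x - W.φ₂ x) : ℂ) * del (Pi.single j 1) χ x) * f j x) 2 W.μ₁ :=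
    memLp_finsetSum _ fun j _ ↦ h2 j
  refine (h1.sub h3).ae_eq (ae_of_all _ fun x ↦ ?_)
  simp only [Pi.sub_apply, cutT, Finset.mul_sum]
  exact congrArg _ (Finset.sum_congr rfl fun j _ ↦ by ring)

/-- `cutS χ f s j k ∈ L²(φ₃)` for a test function `χ`. [cite: HormanderSCV1973, §4.1 (p. 79)] -/
theorem memLp_cutS (h : W.GraphData f t s) (hχ : IsTest χ) (j k : ι) : MemLp (cutS χ f s j k) 2 W.μ₃ := by
  obtain ⟨C, hC⟩ := hχ.continuous.bounded_above_of_compact_support hχ.hasCompactSupport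
  have h1 : MemLp (fun x ↦ χ x * s j k x) 2 W.μ₃ := memLp_two_volW_mul_of_bound W.continuous₃ hχ.continuous hC (h.memLp_s j k)
  have h2 : ∀ (v : ι → ℂ) (m : ι), MemLp (fun x ↦ dbar v χ x * f m x) 2 W.μ₃ := fun v m ↦
    memLp_two_volW_mul_of_hasCompactSupport W.continuous₃ W.continuous₂ (hχ.dbar _).continuous
      (hχ.dbar _).hasCompactSupport (h.memLp_f m)
  exact (h1.add ((h2 (Pi.single j 1) k).sub (h2 (Pi.single k 1) j))).ae_eq
    (ae_of_all _ fun x ↦ by simp only [Pi.add_apply, Pi.sub_apply, cutS])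

/-- The weak `T*`-relation of `χ f`. [cite: HormanderSCV1973, §4.1 (4.1.8)] -/
theorem weakT_smul (h : W.GraphData f t s) (hχ : IsTest χ) :
    HasWeakDelDiv D (fun x j ↦ χ x * f j x * (Real.exp (-W.φ₂ x) : ℂ)) (fun x ↦ -W.cutT χ f t x * (Real.exp (-W.φ₁ x) : ℂ)) := by
  refine (h.weakT.smul hχ.contMDiff).congr_ae (fun j ↦ ae_of_all _ fun x ↦ by ring) (ae_of_all _ fun x ↦ ?_)
  have hE : (Real.exp (W.φ₁ x - W.φ₂ x) : ℂ) * (Real.exp (-W.φ₁ x) : ℂ) = (Real.exp (-W.φ₂ x) : ℂ) := by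
    rw [← ofReal_mul, ← Real.exp_add]; congr 1; ring
  simp only [cutT, Finset.mul_sum]
  rw [neg_sub, sub_mul, Finset.sum_mul]
  have hS : ∑ j, del (Pi.single j 1) χ x * (f j x * (Real.exp (-W.φ₂ x) : ℂ)) =
      ∑ i, (Real.exp (W.φ₁ x - W.φ₂ x) : ℂ) * (del (Pi.single i 1) χ x * f i x) * (Real.exp (-W.φ₁ x) : ℂ) :=
    Finset.sum_congr rfl fun j _ ↦ by linear_combination (-(del (Pi.single j 1) χ x * f j x)) * hE
  rw [hS]; ring

/-- **Multiplier stability of the graph data** (Hörmander (4.1.7)–(4.1.8)): for a test function `χ`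
and graph data `(f, t, s)`, the form `χ f` has graph data `(cutT χ f t, cutS χ f s)`:
`T*(χ f) = χ T* f - e^{φ₁-φ₂} ∑ (∂_j χ) f_j`, `S(χ f) = χ S f + ∂̄χ ∧ f`.
[cite: HormanderSCV1973, §4.1 (4.1.7)–(4.1.8)] -/
theorem smul (h : W.GraphData f t s) (hχ : IsTest χ) :
    W.GraphData (fun j x ↦ χ x * f j x) (W.cutT χ f t) (cutS χ f s) where
  memLp_f := h.memLp_smul_f hχ
  memLp_t := h.memLp_cutT hχ
  memLp_s := h.memLp_cutS hχ
  weakS := h.weakS.smul hχ.contMDiff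
  weakT := h.weakT_smul hχ

/-! ### Cut-off convergence: the first half of Lemma 4.1.3 -/

omit [DecidableEq ι] in
/-- `|v_m| ≤ (∑_j |v_j|²)^{1/2}`. [folklore] -/
theorem norm_le_sqrt_sum_sq (v : ι → ℂ) (m : ι) : ‖v m‖ ≤ √(∑ j, ‖v j‖ ^ 2) :=
  Real.le_sqrt_of_sq_le (Finset.single_le_sum (f := fun j ↦ ‖v j‖ ^ 2) (fun _ _ ↦ sq_nonneg _) (Finset.mem_univ m))

omit [DecidableEq ι] in
/-- **Cauchy–Schwarz**: `|∑ a_j c_j| ≤ (∑ |a_j|²)^{1/2} (∑ |c_j|²)^{1/2}`. [folklore] -/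
theorem norm_sum_mul_le_sqrt (a c : ι → ℂ) : ‖∑ j, a j * c j‖ ≤ √(∑ j, ‖a j‖ ^ 2) * √(∑ j, ‖c j‖ ^ 2) := by
  rw [← Real.sqrt_mul (Finset.sum_nonneg fun j _ ↦ sq_nonneg _)]
  exact Real.le_sqrt_of_sq_le (norm_sum_mul_sq_le a c)

/-- From (4.1.6): `(∑_k |∂̄_k η|²)^{1/2} ≤ e^{a/2}` when `∑_k |∂̄_k η|² ≤ e^{a}`. [folklore] -/
theorem sqrt_le_exp_half {S a : ℝ} (h : S ≤ Real.exp a) : √S ≤ Real.exp (a / 2) := by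
  rw [Real.exp_half]
  exact Real.sqrt_le_sqrt h

variable {η : ℕ → D → ℝ}

/-- `‖(η - 1) z‖ ≤ ‖z‖` for `η ∈ [0, 1]`. [folklore] -/
theorem norm_ofReal_mul_sub_le {r : ℝ} (hr : r ∈ Icc (0 : ℝ) 1) (z : ℂ) : ‖(r : ℂ) * z - z‖ ≤ ‖z‖ := by
  rw [← sub_one_mul, norm_mul, ← ofReal_one, ← ofReal_sub, norm_real, Real.norm_eq_abs]
  have : |r - 1| ≤ 1 := by rw [abs_le]; constructor <;> linarith [hr.1, hr.2]
  exact mul_le_of_le_one_left (norm_nonneg _) this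

/-- **Cut-off convergence for `f`**: `η_ν f_j → f_j` in `L²(φ₂)` (dominated convergence,
`|η_ν f - f| ≤ |f|`). [cite: HormanderSCV1973, Lemma 4.1.3 (proof, p. 80)] -/
theorem tendsto_cutoff_f (h : W.GraphData f t s) (hηs : ∀ ν, ContMDiff 𝓘(ℝ, ι → ℂ) 𝓘(ℝ, ℝ) ∞ (η ν))
    (hη01 : ∀ ν x, η ν x ∈ Icc (0 : ℝ) 1) (hη1 : ∀ x, ∀ᶠ ν in atTop, ∀ᶠ y in 𝓝 x, η ν y = 1) (j : ι) :
    Tendsto (fun ν ↦ eLpNorm (fun x ↦ (η ν x : ℂ) * f j x - f j x) 2 W.μ₂) atTop (𝓝 0) := by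
  refine tendsto_eLpNorm_zero_of_dominated (b := fun x ↦ ‖f j x‖) (fun ν ↦ ?_) (h.memLp_f j).norm
    (fun ν x ↦ norm_ofReal_mul_sub_le (hη01 ν x) _) (fun x ↦ tendsto_zero_of_eventually_eq ?_)
  · exact ((continuous_ofReal.comp (hηs ν).continuous).aestronglyMeasurable.mul (h.memLp_f j).1).sub (h.memLp_f j).1
  · filter_upwards [hη1 x] with ν hν
    rw [show η ν x = 1 from hν.self_of_nhds, ofReal_one, one_mul, sub_self]

/-- The square function `B = ∑_j |f_j|²` has `B e^{-φ₂}` integrable. [folklore] -/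
theorem integrable_sum_norm_sq (h : W.GraphData f t s) :
    Integrable (fun x ↦ (∑ j, ‖f j x‖ ^ 2) * Real.exp (-W.φ₂ x)) D.vol := by
  have := integrable_finsetSum Finset.univ fun j _ ↦ (memLp_two_volW_iff W.continuous₂ (h.aestronglyMeasurable_f j)).1 (h.memLp_f j)
  exact this.congr (ae_of_all _ fun x ↦ by simp only [Finset.sum_mul])

/-- The dominating function `e^{(φ' - φ₂)/2} (∑_j |f_j|²)^{1/2}` lies in `L²(φ')` (its square
weight is `|f|² e^{-φ₂}`). [folklore] -/
theorem memLp_exp_mul_sqrt (h : W.GraphData f t s) {φ' : D → ℝ} (hφ' : Continuous φ') (c : ℝ) :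
    MemLp (fun x ↦ c * (Real.exp ((φ' x - W.φ₂ x) / 2) * √(∑ j, ‖f j x‖ ^ 2))) 2 (D.volW φ') := by
  have hmeas : AEStronglyMeasurable (fun x ↦ c * (Real.exp ((φ' x - W.φ₂ x) / 2) * √(∑ j, ‖f j x‖ ^ 2))) D.vol := by
    refine aestronglyMeasurable_const.mul ((Real.continuous_exp.comp ((hφ'.sub W.continuous₂).div_const _)).aestronglyMeasurable.mul
      (Real.continuous_sqrt.comp_aestronglyMeasurable ?_))
    exact Finset.aestronglyMeasurable_fun_sum Finset.univ fun j _ ↦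
      ((continuous_pow 2).comp_aestronglyMeasurable (h.aestronglyMeasurable_f j).norm :
        AEStronglyMeasurable (fun x ↦ ‖f j x‖ ^ 2) D.vol)
  rw [memLp_two_volW_iff hφ' hmeas]
  refine ((h.integrable_sum_norm_sq).const_mul (c ^ 2)).congr (ae_of_all _ fun x ↦ ?_)
  have hB : 0 ≤ ∑ j, ‖f j x‖ ^ 2 := Finset.sum_nonneg fun j _ ↦ sq_nonneg _
  have hE : Real.exp ((φ' x - W.φ₂ x) / 2) ^ 2 * Real.exp (-φ' x) = Real.exp (-W.φ₂ x) := by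
    rw [← Real.exp_nat_mul, ← Real.exp_add]; congr 1; push_cast; ring
  simp only [Real.norm_eq_abs]
  rw [sq_abs, mul_pow, mul_pow, Real.sq_sqrt hB]
  linear_combination (-(c ^ 2 * ∑ j, ‖f j x‖ ^ 2)) * hE

/-- **Cut-off convergence for `T*`**: under (4.1.6) `∑_k |∂̄_k η_ν|² ≤ e^{φ₂-φ₁}`,
`T*(η_ν f) = η_ν t - e^{φ₁-φ₂} ∑ (∂_j η_ν) f_j → t` in `L²(φ₁)` (dominated convergence with
`|…| ≤ |t| + e^{(φ₁-φ₂)/2} |f|`, the derivatives of `η_ν` vanishing eventually near every point).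
[cite: HormanderSCV1973, Lemma 4.1.3 (proof, p. 80)] -/
theorem tendsto_cutoff_t (h : W.GraphData f t s) (hηs : ∀ ν, ContMDiff 𝓘(ℝ, ι → ℂ) 𝓘(ℝ, ℝ) ∞ (η ν))
    (hηc : ∀ ν, HasCompactSupport (η ν))
    (hη01 : ∀ ν x, η ν x ∈ Icc (0 : ℝ) 1) (hη1 : ∀ x, ∀ᶠ ν in atTop, ∀ᶠ y in 𝓝 x, η ν y = 1)
    (h12 : ∀ ν x, ∑ k, ‖dbar (Pi.single k 1) (fun y ↦ (η ν y : ℂ)) x‖ ^ 2 ≤ Real.exp (W.φ₂ x - W.φ₁ x)) :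
    Tendsto (fun ν ↦ eLpNorm (fun x ↦ W.cutT (fun y ↦ (η ν y : ℂ)) f t x - t x) 2 W.μ₁) atTop (𝓝 0) := by
  have hηt : ∀ ν, IsTest fun y ↦ (η ν y : ℂ) := fun ν ↦ IsTest.ofReal (hηs ν) (hηc ν)
  refine tendsto_eLpNorm_zero_of_dominated
    (b := fun x ↦ ‖t x‖ + 1 * (Real.exp ((W.φ₁ x - W.φ₂ x) / 2) * √(∑ j, ‖f j x‖ ^ 2))) (fun ν ↦ ?_)
    (h.memLp_t.norm.add (h.memLp_exp_mul_sqrt W.continuous₁ 1)) (fun ν x ↦ ?_) (fun x ↦ tendsto_zero_of_eventually_eq ?_)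
  · exact ((h.smul (hηt ν)).memLp_t).1.sub h.memLp_t.1
  · -- the pointwise bound
    rw [cutT, one_mul]
    have h1 : ‖(η ν x : ℂ) * t x - t x‖ ≤ ‖t x‖ := norm_ofReal_mul_sub_le (hη01 ν x) _
    have h2 : ‖(Real.exp (W.φ₁ x - W.φ₂ x) : ℂ) * ∑ j, del (Pi.single j 1) (fun y ↦ (η ν y : ℂ)) x * f j x‖ ≤
        Real.exp ((W.φ₁ x - W.φ₂ x) / 2) * √(∑ j, ‖f j x‖ ^ 2) := by
      rw [norm_mul, norm_real, Real.norm_eq_abs, abs_of_pos (Real.exp_pos _)]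
      have hcs := norm_sum_mul_le_sqrt (fun j ↦ del (Pi.single j 1) (fun y ↦ (η ν y : ℂ)) x) (fun j ↦ f j x)
      have hN : √(∑ j, ‖del (Pi.single j 1) (fun y ↦ (η ν y : ℂ)) x‖ ^ 2) ≤ Real.exp ((W.φ₂ x - W.φ₁ x) / 2) := by
        simp_rw [norm_del_ofReal]
        exact sqrt_le_exp_half (h12 ν x)
      have hE : Real.exp (W.φ₁ x - W.φ₂ x) * Real.exp ((W.φ₂ x - W.φ₁ x) / 2) = Real.exp ((W.φ₁ x - W.φ₂ x) / 2) := by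
        rw [← Real.exp_add]; congr 1; ring
      calc _ ≤ Real.exp (W.φ₁ x - W.φ₂ x) * (√(∑ j, ‖del (Pi.single j 1) (fun y ↦ (η ν y : ℂ)) x‖ ^ 2) * √(∑ j, ‖f j x‖ ^ 2)) :=
            mul_le_mul_of_nonneg_left hcs (Real.exp_pos _).le
        _ ≤ Real.exp (W.φ₁ x - W.φ₂ x) * (Real.exp ((W.φ₂ x - W.φ₁ x) / 2) * √(∑ j, ‖f j x‖ ^ 2)) := by
            gcongr
        _ = _ := by rw [← mul_assoc, hE]
    calc _ = ‖((η ν x : ℂ) * t x - t x) - (Real.exp (W.φ₁ x - W.φ₂ x) : ℂ) *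
          ∑ j, del (Pi.single j 1) (fun y ↦ (η ν y : ℂ)) x * f j x‖ := by congr 1; ring
      _ ≤ _ := (norm_sub_le _ _).trans (add_le_add h1 h2)
  · filter_upwards [hη1 x] with ν hν
    rw [cutT, show η ν x = 1 from hν.self_of_nhds, ofReal_one, one_mul]
    have : ∑ j, del (Pi.single j 1) (fun y ↦ (η ν y : ℂ)) x * f j x = 0 :=
      Finset.sum_eq_zero fun j _ ↦ by rw [del_ofReal_eq_zero_of_eventuallyEq hν, zero_mul]
    rw [this, mul_zero, sub_zero, sub_self]

/-- **Cut-off convergence for `S`**: under (4.1.6) `∑_k |∂̄_k η_ν|² ≤ e^{φ₃-φ₂}`,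
`S(η_ν f) = η_ν s + ∂̄η_ν ∧ f → s` in `L²(φ₃)` (dominated convergence with
`|…| ≤ |s| + 2 e^{(φ₃-φ₂)/2} |f|`). [cite: HormanderSCV1973, Lemma 4.1.3 (proof, p. 80)] -/
theorem tendsto_cutoff_s (h : W.GraphData f t s) (hηs : ∀ ν, ContMDiff 𝓘(ℝ, ι → ℂ) 𝓘(ℝ, ℝ) ∞ (η ν))
    (hηc : ∀ ν, HasCompactSupport (η ν))
    (hη01 : ∀ ν x, η ν x ∈ Icc (0 : ℝ) 1) (hη1 : ∀ x, ∀ᶠ ν in atTop, ∀ᶠ y in 𝓝 x, η ν y = 1)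
    (h23 : ∀ ν x, ∑ k, ‖dbar (Pi.single k 1) (fun y ↦ (η ν y : ℂ)) x‖ ^ 2 ≤ Real.exp (W.φ₃ x - W.φ₂ x)) (j k : ι) :
    Tendsto (fun ν ↦ eLpNorm (fun x ↦ cutS (fun y ↦ (η ν y : ℂ)) f s j k x - s j k x) 2 W.μ₃) atTop (𝓝 0) := by
  have hηt : ∀ ν, IsTest fun y ↦ (η ν y : ℂ) := fun ν ↦ IsTest.ofReal (hηs ν) (hηc ν)
  refine tendsto_eLpNorm_zero_of_dominated
    (b := fun x ↦ ‖s j k x‖ + 2 * (Real.exp ((W.φ₃ x - W.φ₂ x) / 2) * √(∑ j, ‖f j x‖ ^ 2))) (fun ν ↦ ?_)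
    ((h.memLp_s j k).norm.add (h.memLp_exp_mul_sqrt W.continuous₃ 2)) (fun ν x ↦ ?_)
    (fun x ↦ tendsto_zero_of_eventually_eq ?_)
  · exact ((h.smul (hηt ν)).memLp_s j k).1.sub (h.memLp_s j k).1
  · -- the pointwise bound
    rw [cutS]
    set N : ℝ := √(∑ m, ‖dbar (Pi.single m 1) (fun y ↦ (η ν y : ℂ)) x‖ ^ 2) with hN
    set B : ℝ := √(∑ j, ‖f j x‖ ^ 2) with hB
    have h1 : ‖(η ν x : ℂ) * s j k x - s j k x‖ ≤ ‖s j k x‖ := norm_ofReal_mul_sub_le (hη01 ν x) _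
    have hNle : N ≤ Real.exp ((W.φ₃ x - W.φ₂ x) / 2) := sqrt_le_exp_half (h23 ν x)
    have hdb : ∀ m, ‖dbar (Pi.single m 1) (fun y ↦ (η ν y : ℂ)) x‖ ≤ N := fun m ↦
      norm_le_sqrt_sum_sq (fun m ↦ dbar (Pi.single m 1) (fun y ↦ (η ν y : ℂ)) x) m
    have hfb : ∀ m, ‖f m x‖ ≤ B := fun m ↦ norm_le_sqrt_sum_sq (fun m ↦ f m x) m
    have hN0 : 0 ≤ N := Real.sqrt_nonneg _
    have hB0 : 0 ≤ B := Real.sqrt_nonneg _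
    have h2 : ‖dbar (Pi.single j 1) (fun y ↦ (η ν y : ℂ)) x * f k x - dbar (Pi.single k 1) (fun y ↦ (η ν y : ℂ)) x * f j x‖ ≤
        2 * (Real.exp ((W.φ₃ x - W.φ₂ x) / 2) * B) := by
      calc _ ≤ ‖dbar (Pi.single j 1) (fun y ↦ (η ν y : ℂ)) x * f k x‖ + ‖dbar (Pi.single k 1) (fun y ↦ (η ν y : ℂ)) x * f j x‖ :=
            norm_sub_le _ _
        _ ≤ N * B + N * B := by
            rw [norm_mul, norm_mul]
            exact add_le_add (mul_le_mul (hdb j) (hfb k) (norm_nonneg _) hN0) (mul_le_mul (hdb k) (hfb j) (norm_nonneg _) hN0)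
        _ ≤ _ := by nlinarith [mul_le_mul_of_nonneg_right hNle hB0]
    calc _ = ‖((η ν x : ℂ) * s j k x - s j k x) + (dbar (Pi.single j 1) (fun y ↦ (η ν y : ℂ)) x * f k x -
          dbar (Pi.single k 1) (fun y ↦ (η ν y : ℂ)) x * f j x)‖ := by congr 1; ring
      _ ≤ _ := (norm_add_le _ _).trans (add_le_add h1 h2)
  · filter_upwards [hη1 x] with ν hν
    rw [cutS, show η ν x = 1 from hν.self_of_nhds, ofReal_one, one_mul, dbar_ofReal_eq_zero_of_eventuallyEq hν,
      dbar_ofReal_eq_zero_of_eventuallyEq hν]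
    ring

end GraphData

end Weights

end RiemannDomain

end Literature.Analysis.Complex
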